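import Summits.CriticalPhenomena.PercolationContinuityZ3.Theorems.FK.Transplant.KNFreeLawInterfaces
import HarnessLib

/-!
# FK transplant, row FT-04 (2/3): Kozma–Nitzan Lemma 11 — elongated boxes are hittable — for a law family

**Framing.** The transplant theorem of record of this sub-cell
(`ufsc0_of_freeBoundaryHypothesis_r0`, `Transplant/FreeBoundaryTransplant.lean`) is CONDITIONAL on the
free-boundary hypothesis FH (open at the same `p` for `q > 1`; over `p > p_c(q)` it is GRC Conj. (5.103) /
Duminil-Copin–Tassion Q5 territory, calibration K1; barrier note
`Literature.Barriers.CriticalPhenomena.SamePFreeBoundaryCriteria`); it is a typed reduction, not a proof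
of continuity of the FK transition. Builds on p205010 (kernel theorem, internal audit signed; external
expert review pending). THIS file states and discharges NO binder of the record: it is law-abstract
infrastructure (cell `bschramm/fk-continuity`, FRONTIER TRANSPLANT, registry row FT-04, writer fkt-p2;
`--supports stmt-CriticalPhenomena-4575 --as helper`).

Law-abstract port of the measure-dependent half of the Lemma-11 part of the tree's `q = 1` file
`Literature/Probability/Percolation/KozmaNitzanCorridor.lean` (G. Kozma, S. Nitzan, arXiv:2401.12397, §4,
Lemma 11, pp. 22–23): for a law family `μ` satisfying `LawMono`, `LawExt`, `LawNull`, `LawOne`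
(`KNFreeLawInterfaces.lean`), the target property `TargetPropertyLaw μ p` (KN Lemma 10's conclusion) and
the hittability of the quarter-face geometries (`IsHittableLaw μ p (qfGeom a τ)` — for `μ = fkLaw · · q`
exactly the cell's hypothesis of record `FH d q p`) make every elongated geometry
`[-1,1]^d → far face of [-1,K]×[-1,1]^{d-1}` hittable (`isHittableLaw_of_mem_elongList`; for
`μ = fkLaw · · q` the PROVE binder `KNFreeElongatedHittable` of the record). The geometry (`EData`,
`StepOK`, `ChainOK`, `isTarget_step`, `elongGeom`, …) is imported from the `q = 1` file; KN's graph `Ω` is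
the weighting `EData.omegaW` (box restricted, seed lattice edges pinned to `1`: the cell's `hitW` of the
elongated geometry, `lookW_elongGeom`); the proof is `8K - 4` applications of the target property under
ONE fixed weighting (no conditioning), started from KN (27) — one free look at a quarter face of
`Λ_{L₀} ⊆ Ω`, transported by `LawExt` + `LawMono`, the wired seed a.s. open (`LawOne`) — and closed by
weight monotonicity in the seed (`LawMono`) with the open pairs a.s. inside the box (`LawNull`). The
tree's `q = 1` un-wiring identity (`EData.real_W_biUnion_openConn`, KN p. 23 "Going back to ℤ^d") is not
used: hittability is stated with the seed wired.

## References

* G. Kozma, S. Nitzan, arXiv:2401.12397 (2024), §4 Lemma 11 (pp. 22–23), (27), Lemma 9 p. 16. [KozmaNitzan2024]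
* G. Grimmett, *The Random-Cluster Model*, Springer 2006: Thm. (3.21), eq. (3.22). [Grimmett2006]
-/

noncomputable section

open MeasureTheory ProbabilityTheory
open scoped ENNReal

namespace Summit.CriticalPhenomena.PercolationContinuityZ3.Theorems.FK

open Literature.Probability.Percolation Literature.Probability.LatticeModels SimpleGraph
open Literature.Probability.Percolation.KozmaNitzan

variable {d : ℕ}
/-! ## KN's graph `Ω` of Lemma 11 as a weighting -/

namespace EDataFK

open KozmaNitzan.EData

variable (E : EData d)

/-- **The weighting `Ω`** of KN Lemma 11 in the cell's presentation: lattice weights on the pairs inside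
the elongated box, the lattice edges of the seed cube `Λ_k` pinned to weight `1` (KN: "identifying the
cube `[-n,n]^d` to a point"; the tree's `EData.W` wires ALL pairs of the cube instead, which has the same
effect at `q = 1`). For `E = elongData a σ K r k` this is the free-look weighting `lookW` of the elongated
geometry at scale `r` with seed `Λ_k` (`lookW_elongGeom`). [cite: KozmaNitzan2024, §4 p. 22 (the graph Ω)] -/
def omegaW (p : unitInterval) : Sym2 (Site d) → unitInterval :=
  restrW (↑E.bigBox : Set (Site d))
    (pinW (lattW d p) ↑(edgesIn (zdGraph d) (GM.ball (0 : Site d) E.k)) ↑(edgesIn (zdGraph d) (GM.ball (0 : Site d) E.k)))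

/-- `Ω` is supported on the elongated box. [folklore] -/
theorem finSupp_omegaW (p : unitInterval) : FinSupp (omegaW E p) E.bigBox :=
  finSupp_restrW E.bigBox _

variable {E}

/-- The seed ball of `Ω` is the cube `E.cube`. [folklore] -/
theorem mem_ball_iff_mem_cube {z : Site d} : z ∈ GM.ball (0 : Site d) E.k ↔ z ∈ E.cube :=
  mem_gmBall_zero_iff

/-- **The region of one step is a lattice subbox of `Ω`** (the pinned seed edges avoid the region,
which lies in the box). [cite: KozmaNitzan2024, §4 p. 22 (D is a subbox)] -/
theorem isSubbox_omegaW_region {R₀ R : ℕ} {L s w : ℤ} (h : E.StepOK R₀ R L s w) (p : unitInterval) :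
    IsSubbox (omegaW E p) p (E.region L s) := by
  refine ((isSubbox_lattW p (E.region L s)).pinW _ fun e he x hx => ?_).restrW
    (Finset.coe_subset.2 (region_subset_bigBox h))
  rw [Finset.mem_coe, mem_edgesIn_iff] at he
  exact cube_disjoint_region h x (Finset.mem_coe.2 (mem_ball_iff_mem_cube.1 (he.2 x hx)))

end EDataFK

open EDataFK

/-- The cube `Λ_L` (`L ≤ r`) lies in the elongated box `{-r ≤ σ x_a ≤ Kr, |x_j| ≤ r}` (`K ≥ 1`). [folklore] -/
theorem box_subset_bigBox (E : EData d) (hK : 1 ≤ E.K) {L : ℕ} (hL : L ≤ E.r) :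
    (↑(box d L) : Set (Site d)) ⊆ ↑E.bigBox := by
  intro z hz
  rw [Finset.mem_coe, mem_box] at hz
  rw [Finset.mem_coe, EData.mem_bigBox_iff]
  have hL' : (L : ℤ) ≤ E.r := by exact_mod_cast hL
  have hK' : (1 : ℤ) ≤ E.K := by exact_mod_cast hK
  have hrK : (E.r : ℤ) ≤ E.K * E.r := by nlinarith
  have hza := level_bounds_of_symm E.hσ (hz E.a).1 (hz E.a).2
  refine ⟨⟨by linarith [hza.1], by linarith [hza.2]⟩, fun j _ => ?_⟩
  have := hz j
  constructor <;> linarith [this.1, this.2]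

/-- The free-look weighting of the elongated geometry at scale `r` with seed `Λ_m` is `Ω` of the datum
`elongData a σ K r m`. [folklore] -/
theorem lookW_elongGeom (p : unitInterval) (a : Fin d) (σ : ℤˣ) (K : ℕ) (hK : 1 ≤ K) (r m : ℕ) :
    lookW p (elongGeom a σ K hK) r m 0 = omegaW (elongData a σ K r m) p := by
  rw [lookW, elongGeom_Qset a σ K hK m r]
  rfl

/-! ## Lemma 11: one step, the chain, the elongated box -/

section Lemma11

variable (μ : Finset (Site d) → (Sym2 (Site d) → unitInterval) → Measure (BondConfig (Site d)))

/-- **One step of Lemma 11 for the law family `μ`** (an application of the target property in `Ω` with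
the quarter-face geometries; law-swapped `KozmaNitzan.EData.levelStep_of_target`): there are `δ > 0`
and `R₀` such that, for every admissible step, reaching the face `{σ x_a = L, |x_j| ≤ w}` from `o = 0`
(the wired cube) with probability `> 1 - δ` forces reaching `{σ x_a = L + s, |x_j| ≤ w + R}` with
probability `> 1 - ε`. [cite: KozmaNitzan2024, §4 pp. 22–23] -/
theorem levelStepLaw [NeZero d] (p : unitInterval) (hT : TargetPropertyLaw μ p)
    (hqf : ∀ g ∈ qfList d, IsHittableLaw μ p g) {ε : ℝ} (hε : 0 < ε) :
    ∃ δ : ℝ, 0 < δ ∧ ∃ R₀ : ℕ, ∀ (E : EData d) (R : ℕ) (L s w : ℤ), E.StepOK R₀ R L s w →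
      1 - δ < (μ E.bigBox (omegaW E p)).real (⋃ b ∈ E.face L w, openConn (0 : Site d) b) →
        1 - ε < (μ E.bigBox (omegaW E p)).real (⋃ b ∈ E.face (L + s) (w + R), openConn (0 : Site d) b) := by
  obtain ⟨δ, hδ, hH⟩ := hT hε
  obtain ⟨R₀, hR₀⟩ := hH (qfList d) hqf
  refine ⟨δ, hδ, R₀, fun E R L s w hok hB => ?_⟩
  exact hR₀ (omegaW E p) E.bigBox (E.region L s) (sLo E.a E.σ 0 L L w) (sHi E.a E.σ 0 L L w)
    (E.face (L + s) (w + R)) 0 (finSupp_omegaW E p) (isSubbox_omegaW_region hok p)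
    (EData.region_subset_bigBox hok) E.zero_mem_bigBox (EData.zero_not_mem_region hok)
    (EData.enlarge_face_subset_region hok) (EData.isTarget_step hok) (EData.face_subset_region hok)
    (EData.face_nonempty hok) hB

/-- **The chain of Lemma 11 for the law family `μ`**: `N` steps of `levelStepLaw` move the reached face
from level `L`, width `w`, to level `L + Ns`, width `w + NR` (KN: "We repeat this `4K - 3` more times,
each time moving the face by `¼r`, inflating it by `R` and moving from `ε_{i+1}` to `ε_i`").
[cite: KozmaNitzan2024, §4 p. 23] -/
theorem levelChainLaw [NeZero d] (p : unitInterval) (hT : TargetPropertyLaw μ p)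
    (hqf : ∀ g ∈ qfList d, IsHittableLaw μ p g) (N : ℕ) {ε : ℝ} (hε : 0 < ε) :
    ∃ δ : ℝ, 0 < δ ∧ ∃ R₀ : ℕ, ∀ (E : EData d) (R : ℕ) (L s w : ℤ), E.ChainOK R₀ R N L s w →
      1 - δ < (μ E.bigBox (omegaW E p)).real (⋃ b ∈ E.face L w, openConn (0 : Site d) b) →
        1 - ε < (μ E.bigBox (omegaW E p)).real
          (⋃ b ∈ E.face (L + N * s) (w + N * R), openConn (0 : Site d) b) := by
  induction N generalizing ε with
  | zero =>
    refine ⟨ε, hε, 0, fun E R L s w _ hB => ?_⟩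
    simpa using hB
  | succ N ih =>
    obtain ⟨δ', hδ', R₁, h1⟩ := ih hε
    obtain ⟨δ, hδ, R₂, h2⟩ := levelStepLaw μ p hT hqf hδ'
    refine ⟨δ, hδ, max R₁ R₂, fun E R L s w hok hB => ?_⟩
    have hR : max R₁ R₂ ≤ R := hok.hR
    have step := h2 E R L s w (hok.stepOK (le_of_max_le_right hR)) hB
    have hok' : E.ChainOK R₁ R N (L + s) s (w + R) :=
      { hok.shift with hR := le_of_max_le_left hR }
    have rest := h1 E R (L + s) s (w + R) hok' step
    have e1 : L + s + (N : ℤ) * s = L + ((N + 1 : ℕ) : ℤ) * s := by push_cast; ring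
    have e2 : w + (R : ℤ) + (N : ℤ) * R = w + ((N + 1 : ℕ) : ℤ) * R := by push_cast; ring
    rw [e1, e2] at rest
    exact rest

/-- **KN Lemma 11 for the law family `μ`: the elongated-box geometry is `μ`-hittable** for every
direction `a`, sign `σ` and integer `K ≥ 2`, given the structural hypotheses, the target property and
the hittability of the quarter faces (law-swapped `KozmaNitzan.isHittable_elongGeom_of_target`: `8K - 4`
steps of `levelChainLaw` in `Ω`, started from a full face of the cube `Λ_{L₀}`, `L₀ = Kr - (8K-4)⌊r/8⌋`,
reached from the wired `Λ_k` by the quarter-face hittability inside `Λ_{L₀} ⊆ Ω` (KN (27)) and weight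
monotonicity; the seed edges are a.s. open, the open pairs a.s. inside the box).
[cite: KozmaNitzan2024, §4 Lemma 11 (pp. 22–23)] -/
theorem isHittableLaw_elongGeom [NeZero d] (hμ : LawMono μ) (hext : LawExt μ) (hnull : LawNull μ)
    (hone : LawOne μ) (hfin : ∀ Λ W, IsFiniteMeasure (μ Λ W)) (p : unitInterval)
    (hT : TargetPropertyLaw μ p) (hqf : ∀ (a : Fin d) (τ : Fin d → ℤˣ), IsHittableLaw μ p (qfGeom a τ))
    (a : Fin d) (σ : ℤˣ) (K : ℕ) (hK : 2 ≤ K) :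
    IsHittableLaw μ p (elongGeom a σ K (by omega)) := by
  have hK1 : 1 ≤ K := by omega
  have hqf' : ∀ g ∈ qfList d, IsHittableLaw μ p g := by
    intro g hg
    obtain ⟨x, -, rfl⟩ := List.mem_map.1 hg
    exact hqf x.1 x.2
  intro ε hε
  set N : ℕ := 8 * K - 4 with hNdef
  have hN : (N : ℤ) = 8 * K - 4 := by rw [hNdef]; omega
  obtain ⟨δ, hδ, R₀, hchain⟩ := levelChainLaw μ p hT hqf' N hε
  set τ₀ : Fin d → ℤˣ := fun _ => σ with hτ₀
  obtain ⟨k, n₁, hlink⟩ := hqf a τ₀ δ hδ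
  set A : ℕ := 3 * K + 3 * K * R₀ + k + n₁ + 8 with hAdef
  refine ⟨k, 8 * A, fun m hm r hr => ?_⟩
  rw [lookW_elongGeom p a σ K hK1 r m, elongGeom_Qset a σ K hK1 m r, elongGeom_Fset a σ K hK1 m r]
  -- the parameters of the chain
  set s : ℕ := r / 8 with hsdef
  have hs1 : 8 * s ≤ r := Nat.mul_div_le r 8
  have hs2 : r < 8 * s + 8 := by
    have := Nat.div_add_mod r 8; have := Nat.mod_lt r (show 0 < 8 by norm_num); omega
  have hAs : A ≤ s := by
    rw [hsdef]; exact (Nat.le_div_iff_mul_le (by norm_num)).2 (by linarith)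
  set E : EData d := elongData a σ K r k with hE
  set Em : EData d := elongData a σ K r m with hEm
  set L₀ : ℤ := K * r - N * s with hL₀
  -- casts
  have hK' : (2 : ℤ) ≤ K := by exact_mod_cast hK
  have hs1' : 8 * (s : ℤ) ≤ r := by exact_mod_cast hs1
  have hs2' : (r : ℤ) < 8 * s + 8 := by exact_mod_cast hs2
  have hAs' : (A : ℤ) ≤ s := by exact_mod_cast hAs
  have hA' : (A : ℤ) = 3 * K + 3 * K * R₀ + k + n₁ + 8 := by rw [hAdef]; push_cast; ring
  have hKr1 : (K : ℤ) * (8 * s) ≤ K * r := mul_le_mul_of_nonneg_left hs1' (by positivity)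
  have hKr2 : (K : ℤ) * r ≤ K * (8 * s + 8) := mul_le_mul_of_nonneg_left hs2'.le (by positivity)
  have hKR0 : (0 : ℤ) ≤ K * R₀ := by positivity
  have hNs : (N : ℤ) * s = 8 * (K * s) - 4 * s := by rw [hN]; ring
  have hNR : (N : ℤ) * R₀ = 8 * (K * R₀) - 4 * R₀ := by rw [hN]; ring
  have hKR : (R₀ : ℤ) ≤ K * R₀ := by
    have : (1 : ℤ) * R₀ ≤ K * R₀ := mul_le_mul_of_nonneg_right (by linarith) (by positivity)
    linarith
  have hrK : (r : ℤ) ≤ K * r := by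
    have : (1 : ℤ) * r ≤ K * r := mul_le_mul_of_nonneg_right (by linarith) (by positivity)
    linarith
  have hL₀lo : 4 * (s : ℤ) ≤ L₀ := by rw [hL₀]; linarith
  have hL₀hi : L₀ ≤ 4 * (s : ℤ) + 8 * K := by rw [hL₀]; linarith
  have hL₀r : L₀ ≤ r := by linarith
  -- the chain conditions
  have hok : E.ChainOK R₀ R₀ N L₀ s L₀ :=
    { hR := le_rfl
      hs := by linarith
      hw := by linarith
      hr := by
        show L₀ + (N : ℤ) * R₀ + s + 2 * R₀ ≤ (r : ℤ)
        linarith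
      hk := by
        show ((k : ℕ) : ℤ) < L₀ - 2 * s
        linarith
      hK := by
        show L₀ + (N : ℤ) * s ≤ (K : ℤ) * r
        rw [hL₀]; linarith
      hkr := by
        show k ≤ r
        have : (k : ℤ) ≤ r := by linarith
        exact_mod_cast this
      hK1 := by show 1 ≤ K; omega }
  have hL₀0 : 0 ≤ L₀ := by linarith
  set L₀' : ℕ := L₀.toNat with hL₀'
  have hL₀cast : (L₀' : ℤ) = L₀ := Int.toNat_of_nonneg hL₀0
  have hn₁ : n₁ ≤ L₀' := by
    have : (n₁ : ℤ) ≤ L₀' := by rw [hL₀cast]; linarith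
    exact_mod_cast this
  have hL₀'r : L₀' ≤ r := by
    have : (L₀' : ℤ) ≤ r := by rw [hL₀cast]; exact hL₀r
    exact_mod_cast this
  have hkr : k ≤ r := hok.hkr
  have hboxL₀ : (↑(box d L₀') : Set (Site d)) ⊆ ↑E.bigBox := box_subset_bigBox E hK1 hL₀'r
  have hboxk : (↑(box d k) : Set (Site d)) ⊆ ↑E.bigBox := box_subset_bigBox E hK1 hkr
  haveI := hfin
  -- KN (27): the quarter face of `Λ_{L₀}` in direction `(a, σ)` is reached from the wired `Λ_k`
  have hinit : 1 - δ < (μ E.bigBox (omegaW E p)).real (⋃ b ∈ E.face L₀ L₀, openConn (0 : Site d) b) := by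
    have h1 := hlink k le_rfl L₀' hn₁
    -- the free-look weighting of the quarter face, transported to the box `Ω`
    set Wq := lookW p (qfGeom a τ₀) L₀' k 0 with hWq
    have hQ : (qfGeom a τ₀).Qset L₀' 0 = box d L₀' := qfGeom_Qset a τ₀ L₀'
    have hfs : FinSupp Wq (box d L₀') := by rw [hWq, lookW, hQ]; exact finSupp_restrW _ _
    have hWle : Wq ≤ omegaW E p := by
      rw [hWq, lookW, hQ]
      exact restrW_mono_set hboxL₀ _
    rw [hQ] at h1
    rw [hext hfs (Finset.coe_subset.1 hboxL₀)] at h1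
    -- the event: from the link event of the free look to `0 ↔` the full face, almost surely in `Ω`
    have hev : ∀ᵐ ω ∂(μ E.bigBox (omegaW E p)),
        ω ∈ linkIn (↑(box d L₀') : Set (Site d)) (GM.ball 0 k) ((qfGeom a τ₀).Fset L₀' 0) →
          ω ∈ ⋃ b ∈ E.face L₀ L₀, openConn (0 : Site d) b := by
      filter_upwards [hone E.bigBox (omegaW E p)] with ω hω hωl
      -- the seed's lattice edges are open
      have hseed : (↑(edgesIn (zdGraph d) (box d k)) : Set (Sym2 (Site d))) ⊆ ω := by
        intro e he
        rw [Finset.mem_coe, mem_edgesIn_iff] at he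
        have heb : e ∈ (↑(edgesIn (zdGraph d) (GM.ball (0 : Site d) E.k)) : Set (Sym2 (Site d))) := by
          rw [Finset.mem_coe, mem_edgesIn_iff]
          exact ⟨he.1, fun x hx => mem_gmBall_zero_iff.2 (he.2 x hx)⟩
        have hew : e ∈ wireSet (↑E.bigBox : Set (Site d)) := by
          induction e using Sym2.ind with
          | h x y =>
            rw [mk_mem_wireSet_iff]
            exact ⟨hboxk (Finset.mem_coe.2 (he.2 x (Sym2.mem_mk_left x y))),
              hboxk (Finset.mem_coe.2 (he.2 y (Sym2.mem_mk_right x y))),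
              ((SimpleGraph.mem_edgeSet _).1 he.1).ne⟩
        refine hω e hew ?_
        rw [omegaW, restrW_apply_of_mem _ hew, pinW_apply_of_mem_of_mem _ heb heb]
      obtain ⟨sv, hsv, t, ht, hst⟩ := hωl
      simp only [Set.mem_iUnion, exists_prop]
      refine ⟨t, ?_, ?_⟩
      · -- the face orthant lies on the full face
        rw [mem_qfGeom_Fset_iff, mem_orthantFace, mem_box] at ht
        obtain ⟨htb, hta, -⟩ := ht
        rw [EData.mem_face_iff]
        refine ⟨?_, fun j _ => ?_⟩
        · change (σ : ℤ) * t a = L₀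
          rw [← hL₀cast, ← hta]
        · have := htb j; rw [hL₀cast] at this; exact this
      · -- `0 ↔ sv` inside the open cube, then `sv ↔ t`
        have hsv' : sv ∈ box d k := mem_gmBall_zero_iff.1 hsv
        have h0 : (0 : Site d) ∈ box d k := zero_mem_box d k
        rw [box_eq_Icc] at hsv' h0
        have hseed' : (↑(edgesIn (zdGraph d) (Finset.Icc (-(k : Site d)) (k : Site d))) : Set (Sym2 (Site d))) ⊆ ω := by
          rw [← box_eq_Icc]; exact hseed
        have hp := pathIn_openGraph_of_edgesIn_subset hseed' (exists_pathIn_Icc h0 hsv')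
        rw [DCT16.mem_openConnIn_iff_pathIn] at hst
        exact (reachable_of_pathIn hp).trans (reachable_of_pathIn hst)
    calc 1 - δ < _ := h1
      _ ≤ (μ E.bigBox (omegaW E p)).real
            (linkIn (↑(box d L₀') : Set (Site d)) (GM.ball 0 k) ((qfGeom a τ₀).Fset L₀' 0)) :=
          hμ hWle (isUpperSet_linkIn_site _ _ _) (measurableSet_linkIn _ _ _)
      _ ≤ _ := measureReal_mono_ae hev
  -- the chain
  have hend := hchain E R₀ L₀ s L₀ hok hinit
  have hlev : L₀ + (N : ℤ) * s = r * K := by rw [hL₀]; ring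
  rw [hlev] at hend
  -- back to the geometry: widen the face, enlarge the wired cube, localise the path in the box
  have hwid : L₀ + (N : ℤ) * R₀ ≤ r := by
    have h1 : L₀ + (N : ℤ) * R₀ + s + 2 * R₀ ≤ (r : ℤ) := hok.hr
    have h2 : (0 : ℤ) ≤ s := by positivity
    have h3 : (0 : ℤ) ≤ R₀ := by positivity
    linarith
  have hface : (⋃ b ∈ E.face ((r : ℤ) * K) (L₀ + (N : ℤ) * R₀), openConn (0 : Site d) b) ⊆
      ⋃ b ∈ E.face ((r : ℤ) * K) r, openConn (0 : Site d) b := by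
    intro ω hω
    simp only [Set.mem_iUnion, exists_prop] at hω ⊢
    obtain ⟨t, ht, hω⟩ := hω
    refine ⟨t, ?_, hω⟩
    rw [EData.mem_face_iff] at ht ⊢
    refine ⟨ht.1, fun j hj => ?_⟩
    have h2 := ht.2 j hj
    change -(r : ℤ) ≤ t j ∧ t j ≤ r
    constructor <;> linarith [h2.1, h2.2]
  have hWkm : omegaW E p ≤ omegaW Em p := by
    refine restrW_mono _ (pinW_self_mono_set _ (Finset.coe_subset.2 fun e he => ?_))
    rw [mem_edgesIn_iff] at he ⊢
    exact ⟨he.1, fun x hx => mem_gmBall_zero_iff.2 (box_mono d hm (mem_gmBall_zero_iff.1 (he.2 x hx)))⟩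
  have hev2 : ∀ᵐ ω ∂(μ E.bigBox (omegaW Em p)),
      ω ∈ (⋃ b ∈ E.face ((r : ℤ) * K) r, openConn (0 : Site d) b) →
        ω ∈ linkIn (↑Em.bigBox : Set (Site d)) (GM.ball 0 m) (Em.face (r * K) r) := by
    filter_upwards [hnull E.bigBox (omegaW Em p)] with ω hω hωf
    simp only [Set.mem_iUnion, exists_prop] at hωf
    obtain ⟨t, ht, hωt⟩ := hωf
    have hω' : ∀ e ∈ ω, e ∈ wireSet (↑Em.bigBox : Set (Site d)) := fun e he => by
      by_contra h; exact hω e (restrW_apply_of_not_mem _ h) he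
    refine ⟨0, ?_, t, ht, ?_⟩
    · exact mem_gmBall_zero_iff.2 (zero_mem_box d m)
    · rw [DCT16.mem_openConnIn_iff_pathIn]
      exact pathIn_of_reachable_of_forall_mem_wireSet hω' (Finset.mem_coe.2 Em.zero_mem_bigBox) hωt
  calc 1 - ε < _ := hend
    _ ≤ (μ E.bigBox (omegaW E p)).real (⋃ b ∈ E.face ((r : ℤ) * K) r, openConn (0 : Site d) b) :=
        measureReal_mono hface (measure_ne_top _ _)
    _ ≤ (μ E.bigBox (omegaW Em p)).real (⋃ b ∈ E.face ((r : ℤ) * K) r, openConn (0 : Site d) b) :=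
        hμ hWkm (isUpperSet_biUnion_openConn _ _) (measurableSet_biUnion_openConn _ _)
    _ ≤ _ := measureReal_mono_ae hev2

end Lemma11

section ElongList

variable (μ : Finset (Site d) → (Sym2 (Site d) → unitInterval) → Measure (BondConfig (Site d)))

/-- Every elongated geometry of aspect `K ≥ 2` is `μ`-hittable (Lemma 11 for the law family `μ`, all
directions and signs; for `μ = fkLaw · · q` this is the PROVE binder `KNFreeElongatedHit` of the record).
[cite: KozmaNitzan2024, §4 Lemma 11 (p. 22), p. 30 ("and its image by lattice symmetries")] -/
theorem isHittableLaw_of_mem_elongList [NeZero d] (hμ : LawMono μ) (hext : LawExt μ) (hnull : LawNull μ)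
    (hone : LawOne μ) (hfin : ∀ Λ W, IsFiniteMeasure (μ Λ W)) (p : unitInterval)
    (hT : TargetPropertyLaw μ p) (hqf : ∀ (a : Fin d) (τ : Fin d → ℤˣ), IsHittableLaw μ p (qfGeom a τ))
    (K : ℕ) (hK : 2 ≤ K) : ∀ g ∈ elongList d K (by omega), IsHittableLaw μ p g := by
  intro g hg
  obtain ⟨x, -, rfl⟩ := List.mem_map.1 hg
  exact isHittableLaw_elongGeom μ hμ hext hnull hone hfin p hT hqf x.1 x.2 K hK

end ElongList

end Summit.CriticalPhenomena.PercolationContinuityZ3.Theorems.FK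

end
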